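import Literature.Analysis.FluidPDE.TypeIRateOseenMildRepresentative
import Literature.Analysis.FluidPDE.KNSSNoAxisymmetricTypeIHolds
import Literature.Analysis.FluidPDE.SlabTypeICompactness
import Literature.Analysis.FluidPDE.SuitableWeakCongr
import Literature.Analysis.FluidPDE.LocalTypeICongr
import HarnessLib

/-!
# Crux `RecurrentLiouville` (stmt-NavierStokesRegularity-1589), line `Sketch` — stub `stub_rlAxisymRegular`:
# axisymmetric Type-I profiles of the Albritton–Barker class are regular at the origin

Theorems-only file (no definitions, no named facts).  Let `(u, p)` be a suitable weak solution of
Navier–Stokes (`ν = 1`, `f = 0`) on the backward slab `ℝ³ × ℝ₋ = (-∞, 0) × ℝ³` with a weak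
spatial gradient `G`, finite Albritton–Barker quantity `𝐈(ℝ³ × ℝ₋) < ∞` and the Type-I rate
`‖u(t, x)‖ ≤ C/√(−t)`, and assume that `u` is axisymmetric about the `x₃`-axis almost everywhere on
the parabolic ball `Q(0, 2) = (-4, 0) × B₂(0)` (for every angle `θ`, `u(t, R_θ x) = R_θ u(t, x)`
for a.e. `(t, x) ∈ Q(0, 2)`).  Then the space–time origin is NOT a backward singular point of `u`
(`stub_rlAxisymRegular`): the axisymmetric rung of the crux, i.e. the local theorem of
Seregin–Šverák (an axisymmetric singularity cannot be of Type I; the barrier fact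
`Literature.Barriers.NavierStokesRegularity.AxisymmetricTypeIExclusion`, PROVED in the tree as
`axisymmetricTypeIExclusion_of_tree`) read in the Albritton–Barker class.

Proof.  (1) `u` has a continuous representative `v` on the open slab with the rate everywhere
(`exists_oseenMild_repr_of_typeIBound_lt_top`, the slab form of Albritton–Barker 2019, Thm 1.1,
forward direction).  (2) `v` is EXACTLY axisymmetric on `Q(0, 2)`: both sides of
`v(t, R_θ x) = R_θ v(t, x)` are continuous on the open ball and agree a.e. there (transport of
`u = v` a.e. along the measure-preserving map `(t, x) ↦ (t, R_θ x)`), hence everywhere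
(`Measure.eqOn_open_of_ae_eq`).  (3) The truncation `w = v 𝟙_{‖x‖ < 2}` has globally axisymmetric
slices, equals `u` a.e. on `Q(0, 2) ⊇ Q = 𝒞 × ]-1, 0[` (the Seregin–Šverák unit cylinder), so that
`(w, q)` — `q` the pressure normalised to unit-ball mean zero — solves Navier–Stokes in
distributions on `Q` with `w ∈ L³(Q)` (`𝐈 < ∞`), `q ∈ L^{3/2}(Q)`
(`isSuitableWeakSolutionInBall_of_slab`) and `√(−t) ‖w‖ ≤ C`.  (4) The barrier makes `w`, hence
`u`, essentially bounded on some `Q(0, r)`, contradicting a singular origin.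

## References

* G. Seregin, V. Šverák, *On Type I singularities of the local axi-symmetric solutions of the
  Navier–Stokes equations*, Comm. PDE 34 (2009) = arXiv:0804.1803, Thm. 3.1 (= Thm. 1.1).
  [SereginSverak2009]
* D. Albritton, T. Barker, J. Math. Fluid Mech. 21 (2019), no. 43 = arXiv:1811.00502, Thm 1.1,
  Def. 2.1, §3. [AlbrittonBarker2019]
-/

noncomputable section

-- the sub-problem namespace repeats the summit name (D-0017 layout `Summit.<S>.<P>.Theorems`)
set_option linter.dupNamespace false

namespace Summit.NavierStokesRegularity.NavierStokesRegularity.Theorems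

open MeasureTheory Set Function Filter Topology TopologicalSpace Metric
open Literature.Analysis.FluidPDE
open Literature.Barriers.NavierStokesRegularity
open scoped NNReal ENNReal

variable {u : ℝ → EuclideanSpace ℝ (Fin 3) → EuclideanSpace ℝ (Fin 3)}
  {p : ℝ → EuclideanSpace ℝ (Fin 3) → ℝ}
  {G : ℝ → EuclideanSpace ℝ (Fin 3) → EuclideanSpace ℝ (Fin 3) →L[ℝ] EuclideanSpace ℝ (Fin 3)}

/-! ### Geometry: the Seregin–Šverák cylinder inside the parabolic ball `Q(0, 2)` -/

/-- The Seregin–Šverák unit cylinder `Q = 𝒞 × ]-1, 0[` lies in the parabolic ball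
`Q(0, 2) = (-4, 0) × B₂(0)` (`‖x‖ ≤ |x'| + |x₃| < 2`). [folklore] -/
theorem rlAxisymRegular_ssCylinder_subset :
    ssCylinder ⊆ parabolicCylinder 2 (0 : ℝ × EuclideanSpace ℝ (Fin 3)) := by
  intro z hz
  have h2 := norm_lt_two_of_mem_ssCylinder hz
  obtain ⟨ht, -, -⟩ := mem_ssCylinder.1 hz
  rw [SuitableCompactness.mem_parabolicCylinder_zero]
  exact ⟨⟨lt_trans (by norm_num) ht.1, ht.2⟩, h2⟩

/-! ### A continuous representative of an a.e.-axisymmetric field is axisymmetric -/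

/-- **Exact axisymmetry of the continuous representative.**  If `u = v` a.e. on the slab
`(-∞, 0) × ℝ³`, `v` is continuous on the open slab, and for every angle `θ` the identity
`u(t, R_θ x) = R_θ u(t, x)` holds for a.e. `(t, x) ∈ Q(0, 2)`, then `v(t, R_θ x) = R_θ v(t, x)` for
EVERY `(t, x) ∈ Q(0, 2)`: both sides are continuous on the open ball and agree a.e. (the a.e.
identity `u = v` is transported along the measure-preserving map `(t, x) ↦ (t, R_θ x)`, which maps
the slab to itself), so they agree everywhere (`Measure.eqOn_open_of_ae_eq`). [folklore] -/
theorem rlAxisymRegular_eqOn_of_ae {u v : ℝ → EuclideanSpace ℝ (Fin 3) → EuclideanSpace ℝ (Fin 3)}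
    (hae : ∀ᵐ w ∂(volume.restrict (Iio (0 : ℝ) ×ˢ (univ : Set (EuclideanSpace ℝ (Fin 3))))),
      uncurry u w = uncurry v w)
    (hcont : ContinuousOn (uncurry v) (Iio (0 : ℝ) ×ˢ (univ : Set (EuclideanSpace ℝ (Fin 3)))))
    (hax : ∀ θ : ℝ, ∀ᵐ z ∂(volume.restrict (parabolicCylinder 2 (0 : ℝ × EuclideanSpace ℝ (Fin 3)))),
      u z.1 (rotZ θ z.2) = rotZ θ (u z.1 z.2))
    (θ : ℝ) {z : ℝ × EuclideanSpace ℝ (Fin 3)}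
    (hz : z ∈ parabolicCylinder 2 (0 : ℝ × EuclideanSpace ℝ (Fin 3))) :
    v z.1 (rotZ θ z.2) = rotZ θ (v z.1 z.2) := by
  have hQS : parabolicCylinder 2 (0 : ℝ × EuclideanSpace ℝ (Fin 3)) ⊆
      Iio (0 : ℝ) ×ˢ (univ : Set (EuclideanSpace ℝ (Fin 3))) := parabolicCylinder_origin_subset_slab 2
  have hSm : MeasurableSet (Iio (0 : ℝ) ×ˢ (univ : Set (EuclideanSpace ℝ (Fin 3)))) :=
    measurableSet_Iio.prod MeasurableSet.univ
  have hQm : MeasurableSet (parabolicCylinder 2 (0 : ℝ × EuclideanSpace ℝ (Fin 3))) :=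
    (isOpen_parabolicCylinder _ _).measurableSet
  -- the measure-preserving map `(t, x) ↦ (t, R_θ x)` and the transported identity `u = v`
  have hT : MeasurePreserving
      (Prod.map id (rotZ θ) : ℝ × EuclideanSpace ℝ (Fin 3) → ℝ × EuclideanSpace ℝ (Fin 3))
      volume volume :=
    (MeasurePreserving.id (volume : Measure ℝ)).prod (measurePreserving_rotZ θ)
  have h1 : ∀ᵐ w ∂(volume : Measure (ℝ × EuclideanSpace ℝ (Fin 3))),
      w ∈ Iio (0 : ℝ) ×ˢ (univ : Set (EuclideanSpace ℝ (Fin 3))) → uncurry u w = uncurry v w :=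
    (ae_restrict_iff' hSm).1 hae
  have h2 := hT.quasiMeasurePreserving.ae h1
  -- a.e. axisymmetry of `v` on the ball
  have h3 : (fun w : ℝ × EuclideanSpace ℝ (Fin 3) => v w.1 (rotZ θ w.2)) =ᵐ[volume.restrict
      (parabolicCylinder 2 (0 : ℝ × EuclideanSpace ℝ (Fin 3)))] fun w => rotZ θ (v w.1 w.2) := by
    filter_upwards [hax θ, ae_restrict_of_ae_restrict_of_subset hQS hae, ae_restrict_of_ae h2,
      ae_restrict_mem hQm] with w hw1 hw2 hw3 hwQ
    have e3 : u w.1 (rotZ θ w.2) = v w.1 (rotZ θ w.2) := hw3 ⟨(hQS hwQ).1, mem_univ _⟩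
    have e2 : u w.1 w.2 = v w.1 w.2 := hw2
    rw [← e3, hw1, e2]
  -- both sides are continuous on the open ball
  have hO : IsOpen (parabolicCylinder 2 (0 : ℝ × EuclideanSpace ℝ (Fin 3))) :=
    isOpen_parabolicCylinder _ _
  have hf : ContinuousOn (fun w : ℝ × EuclideanSpace ℝ (Fin 3) => v w.1 (rotZ θ w.2))
      (parabolicCylinder 2 (0 : ℝ × EuclideanSpace ℝ (Fin 3))) := by
    have hTc : Continuous
        (Prod.map id (rotZ θ) : ℝ × EuclideanSpace ℝ (Fin 3) → ℝ × EuclideanSpace ℝ (Fin 3)) :=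
      continuous_id.prodMap (continuous_rotZ θ)
    exact hcont.comp hTc.continuousOn fun w hw => ⟨(hQS hw).1, mem_univ _⟩
  have hg : ContinuousOn (fun w : ℝ × EuclideanSpace ℝ (Fin 3) => rotZ θ (v w.1 w.2))
      (parabolicCylinder 2 (0 : ℝ × EuclideanSpace ℝ (Fin 3))) :=
    (continuous_rotZ θ).comp_continuousOn (hcont.mono hQS)
  exact Measure.eqOn_open_of_ae_eq h3 hO hf hg hz

/-! ### The hypotheses of the local Seregin–Šverák theorem -/

/-- **The analytic inputs of the barrier on the unit cylinder.**  For a suitable weak solution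
`(u, q)` on `ℝ³ × ℝ₋` with weak gradient `G`, `𝐈(u, q, G) < ∞` and `q` of unit-ball mean zero, and a
field `w = u` a.e. on the Seregin–Šverák cylinder `Q ⊆ Q(0, 2)`: `(w, q)` solves Navier–Stokes in
the sense of distributions on `Q` (restriction + a.e. modification), `w ∈ L³(Q)`
(`‖u‖_{L³(Q(0,2))} ≤ (4 𝐈)^{1/3}`) and `q ∈ L^{3/2}(Q)` (Albritton–Barker's class Def. 2.1 on
`Q(0, 2)`, `isSuitableWeakSolutionInBall_of_slab`). [cite: AlbrittonBarker2019, Def. 2.1 and §3 (3.3)] -/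
theorem rlAxisymRegular_inputs {w : ℝ → EuclideanSpace ℝ (Fin 3) → EuclideanSpace ℝ (Fin 3)}
    {q : ℝ → EuclideanSpace ℝ (Fin 3) → ℝ}
    (hswq : IsSuitableWeakSolutionOn (slab (EuclideanSpace ℝ (Fin 3)) (Iio 0) isOpen_Iio) 1 0 u q)
    (hwg : HasWeakSpatialGradientOn (slab (EuclideanSpace ℝ (Fin 3)) (Iio 0) isOpen_Iio) u G)
    (hIq : typeIBound (Iio (0 : ℝ) ×ˢ univ) u q G ≠ ⊤)
    (h0 : ∀ t, ⨍ y in ball (0 : EuclideanSpace ℝ (Fin 3)) 1, q t y = 0)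
    (hw : ∀ᵐ z ∂(volume.restrict ssCylinder), uncurry u z = uncurry w z) :
    IsDistributionalNSSolutionOn ssCylinderOpens 1 0 w q ∧
      (∫⁻ z in ssCylinder, ‖w z.1 z.2‖ₑ ^ (3 : ℕ) < ∞) ∧
      (∫⁻ z in ssCylinder, ‖q z.1 z.2‖ₑ ^ (3 / 2 : ℝ) < ∞) := by
  have hle : ssCylinderOpens ≤ slab (EuclideanSpace ℝ (Fin 3)) (Iio 0) isOpen_Iio := fun z hz =>
    mem_slab.2 (mem_ssCylinder.1 hz).1.2
  have hsub2 : ssCylinder ⊆ parabolicCylinder 2 (0 : ℝ × EuclideanSpace ℝ (Fin 3)) :=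
    rlAxisymRegular_ssCylinder_subset
  obtain ⟨h32, h32', h32r⟩ := threeHalves_facts
  refine ⟨(hswq.distributional.of_le hle).congr_ae hw (Eventually.of_forall fun _ => rfl), ?_, ?_⟩
  · -- `w ∈ L³(Q)`
    have h1 : eLpNorm (uncurry u) 3
        (volume.restrict (parabolicCylinder 2 (0 : ℝ × EuclideanSpace ℝ (Fin 3)))) < ∞ := by
      refine lt_of_le_of_lt (eLpNorm_velocity_slab_le two_pos q G) ?_
      exact ENNReal.rpow_lt_top_of_nonneg (by norm_num)
        (ENNReal.mul_ne_top (ENNReal.pow_ne_top ENNReal.ofReal_ne_top) hIq)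
    have h2 : eLpNorm (uncurry w) 3 (volume.restrict ssCylinder) < ∞ := by
      rw [← eLpNorm_congr_ae hw]
      exact lt_of_le_of_lt (eLpNorm_mono_measure _ (Measure.restrict_mono hsub2 le_rfl)) h1
    have h3 := lintegral_rpow_enorm_lt_top_of_eLpNorm_lt_top (by norm_num) (by norm_num) h2
    rw [ENNReal.toReal_ofNat] at h3
    calc ∫⁻ z in ssCylinder, ‖w z.1 z.2‖ₑ ^ (3 : ℕ)
        = ∫⁻ z in ssCylinder, ‖uncurry w z‖ₑ ^ (3 : ℝ) :=
          lintegral_congr fun z => (ENNReal.rpow_ofNat _ 3).symm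
      _ < ∞ := h3
  · -- `q ∈ L^{3/2}(Q)`
    have hball : IsSuitableWeakSolutionInBall 2 0 u q :=
      isSuitableWeakSolutionInBall_of_slab hswq hwg hIq h0 (by norm_num)
    have h2 : eLpNorm (uncurry q) (3 / 2) (volume.restrict ssCylinder) < ∞ :=
      lt_of_le_of_lt (eLpNorm_mono_measure _ (Measure.restrict_mono hsub2 le_rfl))
        hball.2.2.2.eLpNorm_lt_top
    have h3 := lintegral_rpow_enorm_lt_top_of_eLpNorm_lt_top (zero_lt_one.trans_le h32).ne'
      h32' h2
    rw [h32r] at h3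
    exact h3

/-! ### The barrier in the Albritton–Barker class -/

/-- **Regularity from an axisymmetric Type-I representative on `Q(0, 2)`.**  Let `(u, p)` be a
suitable weak solution on `ℝ³ × ℝ₋` with weak gradient `G` and `𝐈 < ∞`, and let `w` be a field
equal to `u` a.e. on `Q(0, 2)`, with axisymmetric slices `w(t)`, `-1 < t < 0`, and the a.e. Type-I
bound `√(−t) ‖w‖ ≤ C` on the Seregin–Šverák cylinder `Q`.  Then the origin is not a backward
singular point of `u`: with the pressure normalised to unit-ball mean zero (`sub_unitBallMean_slab`,
`𝐈` unchanged), `(w, q)` satisfies the hypotheses of the local Seregin–Šverák theorem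
(`rlAxisymRegular_inputs`), whose conclusion — `w ∈ L^∞(Q(0, r))` for some `r > 0`, the barrier
`AxisymmetricTypeIExclusion` proved in tree as `axisymmetricTypeIExclusion_of_tree` — gives
`u ∈ L^∞(Q(0, min r 2))`. [cite: SereginSverak2009, Thm. 3.1 (= Thm. 1.1)] -/
theorem rlAxisymRegular_of_repr
    (hsw : IsSuitableWeakSolutionOn (slab (EuclideanSpace ℝ (Fin 3)) (Iio 0) isOpen_Iio) 1 0 u p)
    (hwg : HasWeakSpatialGradientOn (slab (EuclideanSpace ℝ (Fin 3)) (Iio 0) isOpen_Iio) u G)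
    (hI : typeIBound (Iio (0 : ℝ) ×ˢ univ) u p G < ⊤)
    {w : ℝ → EuclideanSpace ℝ (Fin 3) → EuclideanSpace ℝ (Fin 3)}
    (hw : ∀ᵐ z ∂(volume.restrict (parabolicCylinder 2 (0 : ℝ × EuclideanSpace ℝ (Fin 3)))),
      uncurry u z = uncurry w z)
    (hax : ∀ t ∈ Ioo (-1 : ℝ) 0, IsAxisymmetric (w t))
    (hrate : ∃ C : ℝ, ∀ᵐ z ∂(volume.restrict ssCylinder), Real.sqrt (-z.1) * ‖w z.1 z.2‖ ≤ C) :
    ¬ IsBackwardSingularPoint u 0 := by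
  intro hsing
  -- the normalised pressure
  have hswq := hsw.sub_unitBallMean_slab
  have hIq : typeIBound (Iio (0 : ℝ) ×ˢ univ) u
      (fun t x => p t x - ⨍ y in ball (0 : EuclideanSpace ℝ (Fin 3)) 1, p t y) G ≠ ⊤ := by
    rw [typeIBound_sub_unitBallMean hsw.distributional.2.2.1]
    exact hI.ne
  have h0 : ∀ t, ⨍ y in ball (0 : EuclideanSpace ℝ (Fin 3)) 1,
      (fun t x => p t x - ⨍ y in ball (0 : EuclideanSpace ℝ (Fin 3)) 1, p t y) t y = 0 := fun t =>
    unitBallMean_sub_unitBallMean p t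
  -- the barrier
  have hw' : ∀ᵐ z ∂(volume.restrict ssCylinder), uncurry u z = uncurry w z :=
    ae_restrict_of_ae_restrict_of_subset rlAxisymRegular_ssCylinder_subset hw
  obtain ⟨hdist, hL3, hL32⟩ := rlAxisymRegular_inputs hswq hwg hIq h0 hw'
  obtain ⟨r, hr, hbd⟩ := axisymmetricTypeIExclusion_of_tree w _ hdist hL3 hL32 hax hrate
  -- back to `u` on `Q(0, min r 2)`
  have hr' : 0 < min r 2 := lt_min hr two_pos
  have hmono : parabolicCylinder (min r 2) (0 : ℝ × EuclideanSpace ℝ (Fin 3)) ⊆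
      parabolicCylinder r (0 : ℝ × EuclideanSpace ℝ (Fin 3)) :=
    SuitableCompactness.parabolicCylinder_zero_mono hr'.le (min_le_left _ _)
  have hmono2 : parabolicCylinder (min r 2) (0 : ℝ × EuclideanSpace ℝ (Fin 3)) ⊆
      parabolicCylinder 2 (0 : ℝ × EuclideanSpace ℝ (Fin 3)) :=
    SuitableCompactness.parabolicCylinder_zero_mono hr'.le (min_le_right _ _)
  have e : eLpNorm (uncurry u) ∞
        (volume.restrict (parabolicCylinder (min r 2) (0 : ℝ × EuclideanSpace ℝ (Fin 3)))) =
      eLpNorm (uncurry w) ∞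
        (volume.restrict (parabolicCylinder (min r 2) (0 : ℝ × EuclideanSpace ℝ (Fin 3)))) :=
    eLpNorm_congr_ae (ae_restrict_of_ae_restrict_of_subset hmono2 hw)
  have hlt : eLpNorm (uncurry u) ∞
      (volume.restrict (parabolicCylinder (min r 2) (0 : ℝ × EuclideanSpace ℝ (Fin 3)))) < ∞ := by
    rw [e]
    exact lt_of_le_of_lt (eLpNorm_mono_measure _ (Measure.restrict_mono hmono le_rfl)) hbd
  exact hlt.ne (hsing (min r 2) hr')

/-! ### The stub -/

/-- **Axisymmetric Type-I profiles of the Albritton–Barker class are regular at the origin**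
(stub `stub_rlAxisymRegular` of crux stmt-NavierStokesRegularity-1589, line Sketch, Branch C).
A suitable weak solution `(u, p)` of Navier–Stokes (`ν = 1`, `f = 0`) on `ℝ³ × ℝ₋` with a weak
gradient `G`, `𝐈(ℝ³ × ℝ₋) < ∞`, the Type-I rate `‖u(t, x)‖ ≤ C/√(−t)`, and a.e. axisymmetric about
the `x₃`-axis on `Q(0, 2)` (for every angle), has no backward singularity at the space–time
origin.  Proof: the continuous Oseen-mild representative `v` (Albritton–Barker 2019, Thm 1.1,
forward direction, on the slab) is exactly axisymmetric on `Q(0, 2)` (`rlAxisymRegular_eqOn_of_ae`);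
its truncation `w = v 𝟙_{‖x‖<2}` has axisymmetric slices, equals `u` a.e. on `Q(0, 2)` and keeps
`√(−t) ‖w‖ ≤ C`; conclude by the local Seregin–Šverák theorem in the class
(`rlAxisymRegular_of_repr`).
[cite: SereginSverak2009, Thm. 3.1 (= Thm. 1.1)]
[cite: AlbrittonBarker2019, Thm 1.1 (forward direction, §3)] -/
theorem stub_rlAxisymRegular :
    ∀ (C : ℝ) (u : ℝ → EuclideanSpace ℝ (Fin 3) → EuclideanSpace ℝ (Fin 3))
      (p : ℝ → EuclideanSpace ℝ (Fin 3) → ℝ)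
      (G : ℝ → EuclideanSpace ℝ (Fin 3) → EuclideanSpace ℝ (Fin 3) →L[ℝ] EuclideanSpace ℝ (Fin 3)),
      IsSuitableWeakSolutionOn (slab (EuclideanSpace ℝ (Fin 3)) (Iio 0) isOpen_Iio) 1 0 u p →
      HasWeakSpatialGradientOn (slab (EuclideanSpace ℝ (Fin 3)) (Iio 0) isOpen_Iio) u G →
      typeIBound (Iio (0 : ℝ) ×ˢ univ) u p G < ⊤ →
      HasTypeITimeDecay C u →
      (∀ θ : ℝ, ∀ᵐ z ∂(volume.restrict (parabolicCylinder 2 (0 : ℝ × EuclideanSpace ℝ (Fin 3)))),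
        u z.1 (rotZ θ z.2) = rotZ θ (u z.1 z.2)) →
      ¬ IsBackwardSingularPoint u 0 := by
  intro C u p G hsw hwg hI hdec hax hsing
  -- (1) the continuous representative with the rate everywhere
  obtain ⟨v, hae, hcont, -, -, hrate⟩ := exists_oseenMild_repr_of_typeIBound_lt_top hsw hdec hI
  have hC0 : 0 ≤ C := by
    have h := hrate (-1) (by norm_num) 0
    rw [neg_neg, Real.sqrt_one, div_one] at h
    exact (norm_nonneg _).trans h
  have hQS : parabolicCylinder 2 (0 : ℝ × EuclideanSpace ℝ (Fin 3)) ⊆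
      Iio (0 : ℝ) ×ˢ (univ : Set (EuclideanSpace ℝ (Fin 3))) := parabolicCylinder_origin_subset_slab 2
  -- (2)–(4) the truncated representative `w = v 𝟙_{‖x‖ < 2}` in the barrier
  refine rlAxisymRegular_of_repr hsw hwg hI
    (w := fun t x => if ‖x‖ < 2 then v t x else 0) ?_ ?_ ?_ hsing
  · -- `u = w` a.e. on `Q(0, 2)`
    filter_upwards [ae_restrict_of_ae_restrict_of_subset hQS hae,
      ae_restrict_mem (isOpen_parabolicCylinder _ _).measurableSet] with z hz hzQ
    have h2 : ‖z.2‖ < 2 := (SuitableCompactness.mem_parabolicCylinder_zero.1 hzQ).2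
    rw [hz]
    show v z.1 z.2 = if ‖z.2‖ < 2 then v z.1 z.2 else 0
    rw [if_pos h2]
  · -- the slices of `w` are axisymmetric
    intro t ht θ x
    show (if ‖rotZ θ x‖ < 2 then v t (rotZ θ x) else 0) =
      rotZ θ (if ‖x‖ < 2 then v t x else 0)
    rw [norm_rotZ]
    by_cases hx : ‖x‖ < 2
    · rw [if_pos hx, if_pos hx]
      exact rlAxisymRegular_eqOn_of_ae hae hcont hax θ (z := (t, x))
        (SuitableCompactness.mem_parabolicCylinder_zero.2 ⟨⟨lt_trans (by norm_num) ht.1, ht.2⟩, hx⟩)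
    · rw [if_neg hx, if_neg hx, ← rotZLIE_apply, map_zero]
  · -- the Type-I bound `√(−t) ‖w‖ ≤ C`
    refine ⟨C, (ae_restrict_mem isOpen_ssCylinder.measurableSet).mono fun z hz => ?_⟩
    obtain ⟨ht, -, -⟩ := mem_ssCylinder.1 hz
    have hs : 0 < Real.sqrt (-z.1) := Real.sqrt_pos.2 (neg_pos.2 ht.2)
    show Real.sqrt (-z.1) * ‖(if ‖z.2‖ < 2 then v z.1 z.2 else 0)‖ ≤ C
    by_cases hx : ‖z.2‖ < 2
    · rw [if_pos hx]
      have h := hrate z.1 ht.2 z.2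
      rw [le_div_iff₀ hs] at h
      rw [mul_comm]
      exact h
    · rw [if_neg hx, norm_zero, mul_zero]
      exact hC0

end Summit.NavierStokesRegularity.NavierStokesRegularity.Theorems

end
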